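/-
Copyright (c) 2026. All rights reserved.
Released under Apache 2.0 license as described in the file LICENSE.
Authors: abc-iut cell, seat abc-iut-w6-d067 (gen 5).
-/
import Literature.GroupTheory.InfiniteCharactersNotStronglyComplete
import Literature.GroupTheory.ProPStronglyComplete
import Mathlib.Order.Atoms.Finite
import HarnessLib

/-!
# A pro-`p` group is strongly complete if and only if it is topologically finitely generated

A profinite group is *strongly complete* when every subgroup of finite index is open (L. Ribes,
P. Zalesskii, *Profinite Groups*, §4.2; spelled out, no definition).  For PRO-`p` groups
(profinite groups all of whose continuous finite quotients are `p`-groups) three conditions are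
equivalent, and after this file all three implications are kernel theorems:

* (a) ⟹ (b): topologically finitely generated ⟹ strongly complete — SERRE's theorem
  (J.-P. Serre, *Cohomologie galoisienne* I §4.2 ex. 6; Dixon–du Sautoy–Mann–Segal Thm. 1.17), PROVED
  in the tree by abc-iut-w5-d218 as `Literature.GroupTheory.isOpen_of_finiteIndex_of_proP`;
* (b) ⟹ (c): strongly complete ⟹ only finitely many open normal subgroups of index `p` —
  `Literature.GroupTheory.finite_openNormal_index_eq_of_forall_finiteIndex_isOpen`
  (`InfiniteCharactersNotStronglyComplete.lean`, valid for every compact group);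
* (c) ⟹ (a): **this file**, `exists_finset_dense_of_finite_openNormal_index_eq` — the topological
  BURNSIDE BASIS THEOREM: if a pro-`p` group `P` has only finitely many open normal subgroups of
  index `p`, their intersection `Φ°` is OPEN, and any finite set `S` of representatives of `P/Φ°`
  generates `P` topologically.  (If the closed subgroup `H = cl⟨S⟩` were proper, it would miss a coset
  `gU` of some open normal `U`, so `HU` is a proper open subgroup; in the finite `p`-group `P/U` the
  proper subgroup `HU/U` lies in a maximal subgroup, which is normal of index `p`
  (`normal_and_index_eq_of_isCoatom`); its preimage `M` is an open normal subgroup of index `p`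
  containing `S` and `Φ°`, hence `M = S·Φ° = P` — absurd.)

Packaged: `forall_finiteIndex_isOpen_iff_exists_finset_dense` ((b) ⟺ (a)) and
`exists_finset_dense_iff_finite_openNormal_index_eq` ((a) ⟺ (c)).  Classical
(Ribes–Zalesskii §4.2; DDMS §1.3, Prop. 1.9 / Thm. 1.17); Mathlib + the two tree files; proof-only
(0 definitions).  Relation to the abc-iut FACT-LIST: F-1977 `Rmk253.FiniteIndexOpenOfTopFG`
(Nikolov–Segal) is neither used nor refuted; this file completes the kernel picture of its hypothesis
boundary in the pro-`p` case.  No side taken on [IUTchIII] Cor. 3.12.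

[cite: RibesZalesskii2010, §4.2] [cite: DDMSAnalyticProP1999, Thm 1.17]
[cite: SerreGaloisCohomology1997, I §4.2 ex. 6]
-/

namespace Literature.GroupTheory

open Topology
open scoped Pointwise

universe u

/-! ### Finite `p`-groups: maximal subgroups are normal of index `p` -/

section FinitePGroup

variable {Q : Type u} [Group Q] [Finite Q] {p : ℕ} [hp : Fact p.Prime]

/-- In a finite `p`-group a maximal subgroup is normal of index `p` (maximal subgroups of nilpotent
groups are normal; an element of order `p` of the quotient generates a subgroup whose preimage lies
strictly above).  Private plumbing.
-- adapted from Literature/AlgebraicGeometry/Resolution/TameTowerPGroupTowers.lean (`index_eq_of_isCoatom`)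
[folklore] -/
private theorem normal_and_index_eq_of_isCoatom (hQ : IsPGroup p Q) {H : Subgroup Q}
    (hH : IsCoatom H) : H.Normal ∧ H.index = p := by
  haveI : Group.IsNilpotent Q := hQ.isNilpotent
  have hN : H.Normal :=
    Subgroup.NormalizerCondition.normal_of_coatom H Group.normalizerCondition_of_isNilpotent hH
  refine ⟨hN, ?_⟩
  haveI := hN
  haveI : H.FiniteIndex := Subgroup.finiteIndex_of_finite
  obtain ⟨k, hk⟩ := hQ.index H
  have hk0 : k ≠ 0 := by
    rintro rfl
    rw [pow_zero] at hk
    exact hH.1 (Subgroup.index_eq_one.mp hk)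
  have hdvd : p ∣ Nat.card (Q ⧸ H) := by
    rw [← Subgroup.index_eq_card, hk]
    exact dvd_pow_self p hk0
  obtain ⟨g, hg⟩ := exists_prime_orderOf_dvd_card' p hdvd
  let K : Subgroup Q := (Subgroup.zpowers g).comap (QuotientGroup.mk' H)
  have hHK : H ≤ K := by
    intro x hx
    change QuotientGroup.mk' H x ∈ Subgroup.zpowers g
    rw [QuotientGroup.mk'_apply, (QuotientGroup.eq_one_iff x).mpr hx]
    exact one_mem _
  have hne : H ≠ K := by
    intro hHK'
    obtain ⟨x, rfl⟩ := QuotientGroup.mk'_surjective H g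
    have hxK : x ∈ K := Subgroup.mem_zpowers _
    rw [← hHK'] at hxK
    have h1 : (QuotientGroup.mk' H x) = 1 := by
      rw [QuotientGroup.mk'_apply]
      exact (QuotientGroup.eq_one_iff x).mpr hxK
    rw [h1, orderOf_one] at hg
    exact hp.out.one_lt.ne' hg.symm
  have hKtop : K = ⊤ := hH.2 K (lt_of_le_of_ne hHK hne)
  have hztop : Subgroup.zpowers g = ⊤ := by
    apply Subgroup.comap_injective (QuotientGroup.mk'_surjective H)
    rw [Subgroup.comap_top]
    exact hKtop
  rw [Subgroup.index_eq_card, ← Subgroup.card_top (G := Q ⧸ H), ← hztop, Nat.card_zpowers, hg]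

/-- In a finite `p`-group every proper subgroup lies in a NORMAL subgroup of index `p` (a maximal
subgroup above it).  Private plumbing. [folklore] -/
private theorem exists_normal_index_eq_ge_of_ne_top (hQ : IsPGroup p Q) {L : Subgroup Q}
    (hL : L ≠ ⊤) : ∃ M : Subgroup Q, M.Normal ∧ M.index = p ∧ L ≤ M := by
  obtain ⟨M, hM, hLM⟩ := (eq_top_or_exists_le_coatom L).resolve_left hL
  obtain ⟨hMn, hMi⟩ := normal_and_index_eq_of_isCoatom hQ hM
  exact ⟨M, hMn, hMi, hLM⟩

end FinitePGroup

/-! ### The topological Burnside basis theorem -/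

section ProP

variable {P : Type u} [Group P] [TopologicalSpace P] [IsTopologicalGroup P] [CompactSpace P]
  [TotallyDisconnectedSpace P] {p : ℕ} [Fact p.Prime]

/-- **Topological Burnside basis theorem** — (c) ⟹ (a): a pro-`p` group with only FINITELY many
open normal subgroups of index `p` is topologically finitely generated (by any set of
representatives of the open subgroup `Φ° = ⋂ {N open normal of index p}`).
[cite: RibesZalesskii2010, §4.2] [cite: DDMSAnalyticProP1999, Prop 1.9] -/
theorem exists_finset_dense_of_finite_openNormal_index_eq
    (hP : ∀ U : OpenNormalSubgroup P, IsPGroup p (P ⧸ (U : Subgroup P)))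
    (hfin : Set.Finite {N : Subgroup P | N.Normal ∧ IsOpen (N : Set P) ∧ N.index = p}) :
    ∃ S : Finset P, Dense ((Subgroup.closure (S : Set P) : Subgroup P) : Set P) := by
  classical
  -- `Φ°`, the intersection of the finitely many open normal index-`p` subgroups, is open
  set 𝓜 : Set (Subgroup P) := {N : Subgroup P | N.Normal ∧ IsOpen (N : Set P) ∧ N.index = p} with h𝓜
  set Φ : Subgroup P := sInf 𝓜 with hΦ
  have hΦopen : IsOpen (Φ : Set P) := by
    rw [hΦ, Subgroup.coe_sInf]
    exact hfin.isOpen_biInter fun N hN => hN.2.1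
  have hΦle : ∀ N ∈ 𝓜, Φ ≤ N := fun N hN => sInf_le hN
  -- representatives of the finite quotient `P / Φ°`
  haveI : Finite (P ⧸ Φ) := Subgroup.quotient_finite_of_isOpen Φ hΦopen
  haveI : Fintype (P ⧸ Φ) := Fintype.ofFinite _
  let S : Finset P := Finset.univ.image (Quotient.out : P ⧸ Φ → P)
  have hS : ∀ g : P, ∃ s ∈ S, ∃ k ∈ Φ, g = s * k := by
    intro g
    obtain ⟨k, hk⟩ := QuotientGroup.mk_out_eq_mul Φ g
    refine ⟨(QuotientGroup.mk g : P ⧸ Φ).out, Finset.mem_image_of_mem _ (Finset.mem_univ _),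
      (k : P)⁻¹, Φ.inv_mem k.2, ?_⟩
    rw [hk, mul_inv_cancel_right]
  refine ⟨S, ?_⟩
  -- the closed subgroup `H = cl ⟨S⟩`; suppose it is proper
  set H : Subgroup P := (Subgroup.closure (S : Set P)).topologicalClosure with hH
  rw [dense_iff_closure_eq, ← Subgroup.topologicalClosure_coe, ← hH, Set.eq_univ_iff_forall]
  by_contra hcon
  push Not at hcon
  obtain ⟨g, hg⟩ := hcon
  -- an open normal `U` with `gU ∩ H = ∅`
  have hHc : IsClosed (H : Set P) := Subgroup.isClosed_topologicalClosure _
  have h1 : (1 : P) ∈ (fun x => g * x) ⁻¹' (H : Set P)ᶜ := by simpa using hg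
  obtain ⟨U, hU⟩ := ProfiniteGrp.exist_openNormalSubgroup_sub_open_nhds_of_one
    (hHc.isOpen_compl.preimage (continuous_const.mul continuous_id)) h1
  -- `K = H ⊔ U` is a proper (open) subgroup: `g ∉ K`
  set K : Subgroup P := H ⊔ (U : Subgroup P) with hK
  have hgK : g ∉ K := by
    intro hgK
    have : g ∈ ((H ⊔ (U : Subgroup P) : Subgroup P) : Set P) := hgK
    rw [Subgroup.mul_normal] at this
    obtain ⟨h, hh, u, hu, hhu⟩ := Set.mem_mul.mp this
    have hu' : u⁻¹ ∈ (fun x => g * x) ⁻¹' (H : Set P)ᶜ := hU ((U : Subgroup P).inv_mem hu)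
    apply hu'
    change g * u⁻¹ ∈ (H : Set P)
    rw [← hhu, mul_inv_cancel_right]
    exact hh
  -- in the finite `p`-group `P / U`, the proper subgroup `K / U` lies in a normal index-`p` subgroup
  let π : P →* P ⧸ (U : Subgroup P) := QuotientGroup.mk' (U : Subgroup P)
  have hπ : Function.Surjective π := QuotientGroup.mk'_surjective _
  haveI : Finite (P ⧸ (U : Subgroup P)) :=
    Subgroup.quotient_finite_of_isOpen (U : Subgroup P) U.isOpen
  have hKU : (U : Subgroup P) ≤ K := le_sup_right
  have hcomap : (K.map π).comap π = K := by
    rw [Subgroup.comap_map_eq, QuotientGroup.ker_mk', sup_eq_left.mpr hKU]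
  have hL : K.map π ≠ ⊤ := by
    intro htop
    apply hgK
    rw [← hcomap, htop, Subgroup.comap_top]
    exact Subgroup.mem_top g
  obtain ⟨Mbar, hMn, hMi, hLM⟩ := exists_normal_index_eq_ge_of_ne_top (hP U) hL
  haveI := hMn
  let M : Subgroup P := Mbar.comap π
  have hKM : K ≤ M := by rw [← hcomap]; exact Subgroup.comap_mono hLM
  have hM𝓜 : M ∈ 𝓜 := by
    refine ⟨inferInstance, ?_, ?_⟩
    · exact Subgroup.isOpen_mono (hKU.trans hKM) U.isOpen
    · rw [Subgroup.index_comap_of_surjective Mbar hπ, hMi]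
  -- `M ⊇ S` and `M ⊇ Φ°`, so `M = P`: contradiction with maximality
  have hSM : (S : Set P) ⊆ M := by
    intro s hs
    exact hKM (Subgroup.mem_sup_left (Subgroup.le_topologicalClosure _ (Subgroup.subset_closure hs)))
  have hMtop : M = ⊤ := by
    rw [eq_top_iff]
    intro x _
    obtain ⟨s, hs, k, hk, rfl⟩ := hS x
    exact M.mul_mem (hSM hs) (hΦle M hM𝓜 hk)
  have hMbar : Mbar = ⊤ := by
    apply Subgroup.comap_injective hπ
    rw [Subgroup.comap_top]
    exact hMtop
  have hidx := hMi
  rw [hMbar, Subgroup.index_top] at hidx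
  exact (Fact.out : p.Prime).one_lt.ne hidx

/-- **For a pro-`p` group: strongly complete ⟺ topologically finitely generated** — every
finite-index subgroup is open iff some finite subset generates a dense subgroup.  (⟸) is Serre's
theorem (abc-iut-w5-d218, `isOpen_of_finiteIndex_of_proP`); (⟹) is
`finite_openNormal_index_eq_of_forall_finiteIndex_isOpen` followed by the topological Burnside basis
theorem. [cite: RibesZalesskii2010, §4.2] [cite: DDMSAnalyticProP1999, Thm 1.17] -/
theorem forall_finiteIndex_isOpen_iff_exists_finset_dense
    (hP : ∀ U : OpenNormalSubgroup P, IsPGroup p (P ⧸ (U : Subgroup P))) :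
    (∀ H : Subgroup P, H.FiniteIndex → IsOpen (H : Set P)) ↔
      ∃ S : Finset P, Dense ((Subgroup.closure (S : Set P) : Subgroup P) : Set P) := by
  constructor
  · intro h
    exact exists_finset_dense_of_finite_openNormal_index_eq hP
      (finite_openNormal_index_eq_of_forall_finiteIndex_isOpen (p := p) h)
  · intro hfg H hH
    exact isOpen_of_finiteIndex_of_proP hP hfg H

/-- **For a pro-`p` group: topologically finitely generated ⟺ finitely many open normal subgroups of
index `p`** ((a) ⟺ (c); (⟹) through Serre's theorem and the character count, (⟸) the topological
Burnside basis theorem). [cite: RibesZalesskii2010, §4.2] [cite: DDMSAnalyticProP1999, Prop 1.9] -/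
theorem exists_finset_dense_iff_finite_openNormal_index_eq
    (hP : ∀ U : OpenNormalSubgroup P, IsPGroup p (P ⧸ (U : Subgroup P))) :
    (∃ S : Finset P, Dense ((Subgroup.closure (S : Set P) : Subgroup P) : Set P)) ↔
      Set.Finite {N : Subgroup P | N.Normal ∧ IsOpen (N : Set P) ∧ N.index = p} := by
  constructor
  · intro hfg
    exact finite_openNormal_index_eq_of_forall_finiteIndex_isOpen (p := p)
      fun H hH => isOpen_of_finiteIndex_of_proP hP hfg H
  · exact exists_finset_dense_of_finite_openNormal_index_eq hP

/-- **A pro-`p` group which is NOT topologically finitely generated is NOT strongly complete**: it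
has a subgroup of finite index that is not open (e.g. a free pro-`p` group of infinite rank, such as
the wild inertia group of a `p`-adic local field). [cite: RibesZalesskii2010, §4.2] -/
theorem exists_finiteIndex_not_isOpen_of_not_exists_finset_dense
    (hP : ∀ U : OpenNormalSubgroup P, IsPGroup p (P ⧸ (U : Subgroup P)))
    (hnfg : ¬ ∃ S : Finset P, Dense ((Subgroup.closure (S : Set P) : Subgroup P) : Set P)) :
    ∃ V : Subgroup P, V.FiniteIndex ∧ ¬ IsOpen (V : Set P) := by
  by_contra h
  push Not at h
  exact hnfg ((forall_finiteIndex_isOpen_iff_exists_finset_dense hP).mp fun H hH => h H hH)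

end ProP

end Literature.GroupTheory
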